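import Summits.ABC.ABC.Theorems.TowerExponentWindow.Negative.StubBinomialDepthWindowFloors

/-!
# `TowerExponentWindow` (stmt-ABC-1647) — negative-side lemmas III: the lever of line
`binomial-xi-d-zero-threefold` lives at levels `n ≥ 7` only

Continuation of `StubBinomialDepthWindowFloors` (engine `depth_floor_of_families`, floors `C ≥ 1` everywhere and
`C ≥ 2` at the levels divisible by `4` or `6`).  Here:

* `pade_point`, `nine_fifths_le_of_depth_five` — **`C ≥ 9/5` at level `5`** from the Padé identity
  `(t⁴ − 5t³ + 15t² − 35t + 70)(t+1)⁵ − (126t⁴ + 420t³ + 540t² + 315t + 70) = t⁹` at `t = 11^(j+1)`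
  (the `n = 5` case of `Q(X,Y)Xⁿ − Q(Y,X)Yⁿ = (X−Y)^(2n−1)`, `Q(X,Y) = Σ_{i<n} C(2n−1,n+i)Xⁱ(−Y)^(n−1−i)`,
  which gives `C ≥ 2 − 1/n` at every ODD level; for even `n` no such positive identity exists);
* `seven_le_of_depth_window` — **any witness `(n, C, C')` of the registered stub `stub_binomialDepthWindow`
  (`0 ≤ C`, `3C < n`, depth inequality) has `n ≥ 7`**; `not_depth_window_le_six` refutes the strengthening
  "the lever at some level `≤ 6`"; `depth_window_shape` packages what a proof of the stub must deliver
  (`n ≥ 7`, `C ∈ [1, n/3)`, `C ≥ 2` if `4 ∣ n` or `6 ∣ n`).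

Refuter seat cdisprove-stmt-ABC-1647 (gen 2), 2026-08-16; work file `Cruxes/TowerExponentWindow/Disproof.lean`.
-/

namespace Summit.ABC.ABC.Theorems.TowerExponentWindow.Negative

open Literature.NumberTheory.DiophantineGeometry (radical_le_of_dvd_pow)

/-! ## Floor `9/5` at level `5`: the Padé family

The `[n−1 ∣ n−1]` Padé approximant of `(1+t)ⁿ` is the split of `(X − Y)^(2n−1)` into its `Xⁿ`- and
`Yⁿ`-divisible halves, `Q(X,Y)·Xⁿ − Q(Y,X)·Yⁿ = (X − Y)^(2n−1)` with
`Q(X,Y) = Σ_{i<n} C(2n−1, n+i) Xⁱ(−Y)^(n−1−i)`; at `(X, Y) = (t+1, 1)` both coefficients are positive exactly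
when `n` is odd, and `t = qʲ` gives depth `(2n−1)·j log q` against heights `≈ (n−1)j log q + j log q`:
`C ≥ 2 − 1/n` at every odd level.  Only `n = 5` matters for the census of dead levels (`9/5 > 5/3`):
`A(t) = t⁴ − 5t³ + 15t² − 35t + 70`, `B(t) = 126t⁴ + 420t³ + 540t² + 315t + 70`, `A(t)(t+1)⁵ − B(t) = t⁹`. -/

/-- The level-`5` Padé point at a parameter `t ≥ 6` coprime to `70`: positive `a₁ = A(t)`, `c₁ = B(t)` with
`a₁(t+1)⁵ − c₁ = t⁹`, `gcd(a₁(t+1), c₁) = 1`, `a₁, c₁ ≤ 1471 t⁴`. [folklore] -/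
theorem pade_point (t : ℕ) (h70 : Nat.Coprime t 70) (ht6 : 6 ≤ t) :
    ∃ a₁ c₁ : ℕ, 0 < a₁ ∧ 0 < c₁ ∧ Nat.Coprime (a₁ * (t + 1)) c₁ ∧
      (a₁ : ℤ) * ((t : ℤ) + 1) ^ 5 - c₁ = (t : ℤ) ^ 9 ∧ a₁ ≤ 1471 * t ^ 4 ∧ c₁ ≤ 1471 * t ^ 4 := by
  set A : ℤ := (t : ℤ) ^ 4 - 5 * (t : ℤ) ^ 3 + 15 * (t : ℤ) ^ 2 - 35 * t + 70 with hA
  have ht6' : (6 : ℤ) ≤ t := by exact_mod_cast ht6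
  have hApos : 0 < A := by
    have h1 : 0 ≤ (t : ℤ) ^ 3 * ((t : ℤ) - 6) := mul_nonneg (by positivity) (by linarith)
    have ht2 : 36 ≤ (t : ℤ) ^ 2 := by nlinarith
    have h2 : 36 * (t : ℤ) ≤ (t : ℤ) ^ 3 := by
      rw [show (t : ℤ) ^ 3 = (t : ℤ) ^ 2 * t by ring]; exact mul_le_mul_of_nonneg_right ht2 (by linarith)
    rw [hA]; nlinarith
  have hAcast : ((A.toNat : ℕ) : ℤ) = A := Int.toNat_of_nonneg hApos.le
  set B : ℕ := (126 * t ^ 3 + 294 * t ^ 2 + 246 * t + 69) * (t + 1) + 1 with hB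
  have hBcast : ((B : ℕ) : ℤ) = 126 * (t : ℤ) ^ 4 + 420 * (t : ℤ) ^ 3 + 540 * (t : ℤ) ^ 2 + 315 * t + 70 := by
    rw [hB]; push_cast; ring
  have hid : A * ((t : ℤ) + 1) ^ 5 - (126 * (t : ℤ) ^ 4 + 420 * (t : ℤ) ^ 3 + 540 * (t : ℤ) ^ 2 + 315 * t + 70)
      = (t : ℤ) ^ 9 := by rw [hA]; ring
  have ht1 : (1 : ℤ) ≤ t := by linarith
  refine ⟨A.toNat, B, by omega, by rw [hB]; omega, ?_, by rw [hAcast, hBcast, hid], ?_, ?_⟩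
  · refine Nat.Coprime.mul_left ?_ ?_
    · refine Nat.coprime_of_dvd fun p hp hpa hpb => ?_
      have hpa' : (p : ℤ) ∣ A := by rw [← hAcast]; exact_mod_cast hpa
      have hpb' : (p : ℤ) ∣ ((B : ℕ) : ℤ) := by exact_mod_cast hpb
      have hpt : (p : ℤ) ∣ ((t : ℕ) : ℤ) ^ 9 := by
        rw [← hid, ← hBcast]; exact dvd_sub (dvd_mul_of_dvd_left hpa' _) hpb'
      have hpt' : p ∣ t := hp.dvd_of_dvd_pow (by exact_mod_cast hpt : p ∣ t ^ 9)
      have h70' : (p : ℤ) ∣ 70 := by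
        have e : (70 : ℤ) = A - (t : ℤ) * ((t : ℤ) ^ 3 - 5 * (t : ℤ) ^ 2 + 15 * t - 35) := by rw [hA]; ring
        rw [e]; exact dvd_sub hpa' (dvd_mul_of_dvd_left (by exact_mod_cast hpt') _)
      have hp70 : p ∣ 70 := by exact_mod_cast h70'
      have h1 : p ∣ Nat.gcd t 70 := Nat.dvd_gcd hpt' hp70
      rw [h70.gcd_eq_one] at h1
      exact hp.one_lt.ne' (Nat.dvd_one.mp h1)
    · rw [hB, Nat.coprime_mul_right_add_right]
      exact Nat.coprime_one_right _
  · have h1 : ((A.toNat : ℕ) : ℤ) ≤ 1471 * (t : ℤ) ^ 4 := by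
      rw [hAcast, hA]
      have e4 : (t : ℤ) ^ 2 ≤ (t : ℤ) ^ 4 := pow_le_pow_right₀ ht1 (by norm_num)
      have e0 : (1 : ℤ) ≤ (t : ℤ) ^ 4 := one_le_pow₀ ht1
      have e3 : (0 : ℤ) ≤ (t : ℤ) ^ 3 := by positivity
      linarith
    exact_mod_cast h1
  · have h1 : ((B : ℕ) : ℤ) ≤ 1471 * (t : ℤ) ^ 4 := by
      rw [hBcast]
      have e3 : (t : ℤ) ^ 3 ≤ (t : ℤ) ^ 4 := pow_le_pow_right₀ ht1 (by norm_num)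
      have e2 : (t : ℤ) ^ 2 ≤ (t : ℤ) ^ 4 := pow_le_pow_right₀ ht1 (by norm_num)
      have e1 : (t : ℤ) ≤ (t : ℤ) ^ 4 := le_self_pow₀ ht1 (by norm_num)
      have e0 : (1 : ℤ) ≤ (t : ℤ) ^ 4 := one_le_pow₀ ht1
      linarith
    exact_mod_cast h1

/-- **`C ≥ 9/5` at level `5`**: data `a₁ = A(t)`, `a₂ = t + 1`, `c₁ = B(t)`, `c₂ = 1`, `d = t⁹`, `t = 11^(j+1)`:
depth `9(j+1) log 11` against heights `≤ 5(j+1) log 11 + O(1)`.  So the lever is unsatisfiable at level `5`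
(`3C < 5` would need `C < 5/3 < 9/5`). [folklore] -/
theorem nine_fifths_le_of_depth_five {C C' : ℝ} (hC : 0 ≤ C)
    (h : ∀ a₁ a₂ c₁ c₂ : ℕ, 0 < a₁ → 0 < a₂ → 0 < c₁ → 0 < c₂ → Nat.Coprime (a₁ * a₂) (c₁ * c₂) →
      a₁ * a₂ ^ 5 ≠ c₁ * c₂ ^ 5 → ∀ d : ℕ, 0 < d → (d : ℤ) ∣ ((a₁ * a₂ ^ 5 : ℕ) : ℤ) - ((c₁ * c₂ ^ 5 : ℕ) : ℤ) →
      Real.log (d : ℝ) ≤ C * (Real.log ((max a₁ c₁ : ℕ) : ℝ) + Real.log ((max a₂ c₂ : ℕ) : ℝ) +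
        Real.log ((UniqueFactorizationMonoid.radical d : ℕ) : ℝ)) + C') :
    9 / 5 ≤ C := by
  have hlog11 : 0 < Real.log 11 := Real.log_pos (by norm_num)
  have key := depth_floor_of_families hC h (p := 9) (q := 5) (r := Real.log 1471 + Real.log 2 + Real.log 11)
    (fun j => ((j : ℝ) + 1) * Real.log 11) (fun K => ?_) (fun j => ?_)
  · linarith
  · obtain ⟨j, hj⟩ := exists_nat_ge (K / Real.log 11)
    refine ⟨j, ?_⟩
    have := (div_le_iff₀ hlog11).mp hj
    nlinarith
  · set t : ℕ := 11 ^ (j + 1) with ht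
    have ht11 : 11 ≤ t := by
      rw [ht]
      calc (11:ℕ) = 11 ^ 1 := by norm_num
        _ ≤ 11 ^ (j + 1) := Nat.pow_le_pow_right (by norm_num) (by omega)
    have hlogt : Real.log (t : ℝ) = ((j : ℝ) + 1) * Real.log 11 := by
      rw [ht]; push_cast; rw [Real.log_pow]; push_cast; ring
    obtain ⟨a₁, c₁, ha₁, hc₁, hcop, hid, hale, hcle⟩ :=
      pade_point t (by rw [ht]; exact Nat.Coprime.pow_left _ (by norm_num)) (by omega)
    refine ⟨a₁, t + 1, c₁, 1, t ^ 9, ha₁, by omega, hc₁, one_pos, by positivity, by rwa [mul_one],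
      ?_, ?_, ?_, ?_⟩
    · intro he
      have he' : (a₁ : ℤ) * ((t : ℤ) + 1) ^ 5 = (c₁ : ℤ) * 1 ^ 5 := by exact_mod_cast he
      rw [one_pow, mul_one] at he'
      rw [he', sub_self] at hid
      have : (0 : ℤ) < (t : ℤ) ^ 9 := by positivity
      rw [← hid] at this; exact lt_irrefl _ this
    · simp only [Nat.cast_pow, Nat.cast_mul, Nat.cast_add, Nat.cast_one, one_pow, mul_one]
      rw [hid]
    · rw [← hlogt]; push_cast; rw [Real.log_pow]; push_cast; linarith
    · have ht1 : (1 : ℝ) ≤ (t : ℝ) := by exact_mod_cast ht11.trans' (by norm_num)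
      have htpos : (0 : ℝ) < (t : ℝ) := by linarith
      have hlog1 : Real.log ((max a₁ c₁ : ℕ) : ℝ) ≤ Real.log 1471 + 4 * Real.log (t : ℝ) := by
        have hmax : ((max a₁ c₁ : ℕ) : ℝ) ≤ 1471 * (t : ℝ) ^ 4 := by
          have : max a₁ c₁ ≤ 1471 * t ^ 4 := max_le hale hcle
          exact_mod_cast this
        have hpos1 : (0 : ℝ) < ((max a₁ c₁ : ℕ) : ℝ) := by exact_mod_cast lt_max_of_lt_left ha₁
        calc Real.log ((max a₁ c₁ : ℕ) : ℝ) ≤ Real.log (1471 * (t : ℝ) ^ 4) := Real.log_le_log hpos1 hmax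
          _ = Real.log 1471 + 4 * Real.log (t : ℝ) := by
            rw [Real.log_mul (by norm_num) (by positivity), Real.log_pow]; push_cast; ring
      have hlog2 : Real.log ((max (t + 1) 1 : ℕ) : ℝ) ≤ Real.log 2 + Real.log (t : ℝ) := by
        rw [max_eq_left (by omega : 1 ≤ t + 1)]
        calc Real.log ((t + 1 : ℕ) : ℝ) ≤ Real.log (2 * (t : ℝ)) :=
              Real.log_le_log (by positivity) (by push_cast; linarith)
          _ = Real.log 2 + Real.log (t : ℝ) := Real.log_mul (by norm_num) htpos.ne'
      have hrad : UniqueFactorizationMonoid.radical (t ^ 9) ≤ 11 := by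
        refine radical_le_of_dvd_pow (n := 9 * (j + 1)) (by norm_num) ?_
        rw [ht, ← pow_mul, mul_comm]
      have hlog3 : Real.log ((UniqueFactorizationMonoid.radical (t ^ 9) : ℕ) : ℝ) ≤ Real.log 11 :=
        Real.log_le_log (by exact_mod_cast Nat.radical_pos _) (by exact_mod_cast hrad)
      rw [hlogt] at hlog1 hlog2
      linarith

/-! ## Consequence: the lever lives at levels `n ≥ 7` only -/

/-- **Any witness `(n, C, C')` of the stub `stub_binomialDepthWindow` has `n ≥ 7`** (levels `≤ 3`: floor `1`;
level `4`: floor `2`; level `5`: floor `9/5`; level `6`: floor `2` — each `≥ n/3`). [folklore] -/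
theorem seven_le_of_depth_window {n : ℕ} {C C' : ℝ} (hC : 0 ≤ C) (h3 : 3 * C < n)
    (h : ∀ a₁ a₂ c₁ c₂ : ℕ, 0 < a₁ → 0 < a₂ → 0 < c₁ → 0 < c₂ → Nat.Coprime (a₁ * a₂) (c₁ * c₂) →
      a₁ * a₂ ^ n ≠ c₁ * c₂ ^ n → ∀ d : ℕ, 0 < d → (d : ℤ) ∣ ((a₁ * a₂ ^ n : ℕ) : ℤ) - ((c₁ * c₂ ^ n : ℕ) : ℤ) →
      Real.log (d : ℝ) ≤ C * (Real.log ((max a₁ c₁ : ℕ) : ℝ) + Real.log ((max a₂ c₂ : ℕ) : ℝ) +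
        Real.log ((UniqueFactorizationMonoid.radical d : ℕ) : ℝ)) + C') :
    7 ≤ n := by
  have h4 := four_le_of_depth_window hC h3 h
  by_contra hlt
  have hn : n = 4 ∨ n = 5 ∨ n = 6 := by omega
  rcases hn with rfl | rfl | rfl
  · have := two_le_of_depth_four_dvd (by norm_num) (dvd_refl 4) hC h
    push_cast at h3; linarith
  · have := nine_fifths_le_of_depth_five hC h
    push_cast at h3; linarith
  · have := two_le_of_depth_six_dvd (by norm_num) (dvd_refl 6) hC h
    push_cast at h3; linarith

/-- STRENGTHENING REFUTED: "the lever at some level `n ≤ 6`" — i.e. the registered stub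
`stub_binomialDepthWindow` with the extra constraint `n ≤ 6` is false. [folklore] -/
theorem not_depth_window_le_six :
    ¬ ∃ n : ℕ, n ≤ 6 ∧ ∃ C C' : ℝ, 0 ≤ C ∧ 3 * C < n ∧
      ∀ a₁ a₂ c₁ c₂ : ℕ, 0 < a₁ → 0 < a₂ → 0 < c₁ → 0 < c₂ → Nat.Coprime (a₁ * a₂) (c₁ * c₂) →
      a₁ * a₂ ^ n ≠ c₁ * c₂ ^ n → ∀ d : ℕ, 0 < d → (d : ℤ) ∣ ((a₁ * a₂ ^ n : ℕ) : ℤ) - ((c₁ * c₂ ^ n : ℕ) : ℤ) →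
      Real.log (d : ℝ) ≤ C * (Real.log ((max a₁ c₁ : ℕ) : ℝ) + Real.log ((max a₂ c₂ : ℕ) : ℝ) +
        Real.log ((UniqueFactorizationMonoid.radical d : ℕ) : ℝ)) + C' := by
  rintro ⟨n, hn6, C, C', hC, h3, h⟩
  have := seven_le_of_depth_window hC h3 h
  omega

/-- **Shape of any proof of the stub**: from the registered statement `stub_binomialDepthWindow` (verbatim as
hypothesis) one gets a level `n ≥ 7` and `C ∈ [1, n/3)`, with `C ≥ 2` whenever `4 ∣ n` or `6 ∣ n`. [folklore] -/
theorem depth_window_shape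
    (hS : ∃ n : ℕ, ∃ C C' : ℝ, 0 ≤ C ∧ 3 * C < n ∧ ∀ a₁ a₂ c₁ c₂ : ℕ, 0 < a₁ → 0 < a₂ → 0 < c₁ → 0 < c₂ → Nat.Coprime (a₁ * a₂) (c₁ * c₂) → a₁ * a₂ ^ n ≠ c₁ * c₂ ^ n → ∀ d : ℕ, 0 < d → (d : ℤ) ∣ ((a₁ * a₂ ^ n : ℕ) : ℤ) - ((c₁ * c₂ ^ n : ℕ) : ℤ) → Real.log (d : ℝ) ≤ C * (Real.log ((max a₁ c₁ : ℕ) : ℝ) + Real.log ((max a₂ c₂ : ℕ) : ℝ) + Real.log ((UniqueFactorizationMonoid.radical d : ℕ) : ℝ)) + C') :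
    ∃ n : ℕ, 7 ≤ n ∧ ∃ C C' : ℝ, 1 ≤ C ∧ 3 * C < n ∧ (4 ∣ n ∨ 6 ∣ n → 2 ≤ C) ∧
      ∀ a₁ a₂ c₁ c₂ : ℕ, 0 < a₁ → 0 < a₂ → 0 < c₁ → 0 < c₂ → Nat.Coprime (a₁ * a₂) (c₁ * c₂) →
      a₁ * a₂ ^ n ≠ c₁ * c₂ ^ n → ∀ d : ℕ, 0 < d → (d : ℤ) ∣ ((a₁ * a₂ ^ n : ℕ) : ℤ) - ((c₁ * c₂ ^ n : ℕ) : ℤ) →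
      Real.log (d : ℝ) ≤ C * (Real.log ((max a₁ c₁ : ℕ) : ℝ) + Real.log ((max a₂ c₂ : ℕ) : ℝ) +
        Real.log ((UniqueFactorizationMonoid.radical d : ℕ) : ℝ)) + C' := by
  obtain ⟨n, C, C', hC, h3, h⟩ := hS
  refine ⟨n, seven_le_of_depth_window hC h3 h, C, C', one_le_of_depth hC h, h3, ?_, h⟩
  rintro (h4 | h6)
  · exact two_le_of_depth_four_dvd (by rintro rfl; norm_num at h3; linarith) h4 hC h
  · exact two_le_of_depth_six_dvd (by rintro rfl; norm_num at h3; linarith) h6 hC h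

end Summit.ABC.ABC.Theorems.TowerExponentWindow.Negative
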